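import Mathlib.FieldTheory.RatFunc.Valuation
import Mathlib.FieldTheory.RatFunc.AsPolynomial
import Mathlib.RingTheory.DedekindDomain.AdicValuation
import Mathlib.FieldTheory.IsAlgClosed.AlgebraicClosure
import Mathlib.RingTheory.IntegralClosure.IsIntegralClosure.Basic
import Mathlib.RingTheory.IntegralDomain
import Mathlib.Algebra.Field.ZMod
import Mathlib.Algebra.CharP.Defs
import Mathlib.RingTheory.RegularLocalRing.Defs
import Mathlib.RingTheory.Valuation.ValuationSubring
import HarnessLib

/-!
# Two obstructions about affine models of function fields

Topic: `Literature/AlgebraicGeometry/Resolution`. Negative knowledge recorded by the standing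
disprover of crux `PatchingRel` (stmt-ResolutionOfSingularities-0642, `LUrel_p → ResolutionInChar
p`; `Cruxes/patching_rel/Disproof.lean` §2 (H3) and §7), both folklore:

* `RatFunc.not_exists_model_le_forall_valuationSubring` — **the `ℙ¹` phenomenon**: no subring
  `A ⊆ F(X)` with fraction field `F(X)` is contained in every valuation ring of `F(X)/F`. An
  element lying in the valuation rings of all finite places is a polynomial
  (`IsDedekindDomain.HeightOneSpectrum.mem_integers_of_valuation_le_one`); lying also in the
  valuation ring at infinity (`RatFunc.inftyValuation`) it is a constant; and constants do not
  have fraction field `F(X)` (`v_∞(X) = exp 1`). This is why local uniformizations (affine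
  models, one per valuation) must be GLUED into a proper, non-affine model: Zariski's patching
  step is intrinsic (Zariski–Samuel II, Ch. VI §17; the intersection of all valuation rings of
  `K/k` is the integral closure of `k`).
* `not_exists_fg_isFractionRing_algebraicClosure` — an algebraic extension of infinite degree
  has no affine model: no finitely generated `𝔽_p`-subalgebra of `𝔽_p^alg` has fraction field
  `𝔽_p^alg` (finitely generated + integral ⇒ finite ⇒ a finite field). Hence "local
  uniformization for ALL extensions `K/k`" (finite generation dropped) is false, and an
  implication with that antecedent would be vacuous — the reason `LUrel_p` carries
  `(⊤ : IntermediateField k K).FG`.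

## Sources

* O. Zariski, P. Samuel, *Commutative Algebra* II, Ch. VI §17 (models, the Riemann surface of a
  field; intersection of valuation rings). [ZariskiSamuel1960]
-/

noncomputable section

namespace Literature.AlgebraicGeometry.Resolution

open scoped Polynomial

/-- **No model of `F(X)` lies in every valuation ring of `F(X)/F`** (the `ℙ¹` phenomenon): if a
subalgebra `A ⊆ F(X)` is contained in every valuation ring containing `F`, then `A` consists of
constants, so `Frac A ≠ F(X)`. [cite: ZariskiSamuel1960, Ch. VI §17] -/
theorem RatFunc.not_exists_model_le_forall_valuationSubring (F : Type*) [Field F] :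
    ¬ ∃ A : Subalgebra F (RatFunc F), IsFractionRing A (RatFunc F) ∧
      ∀ O : ValuationSubring (RatFunc F), (∀ c : F, algebraMap F (RatFunc F) c ∈ O) →
        A.toSubring ≤ O.toSubring := by
  classical
  rintro ⟨A, hfr, hA⟩
  set K := RatFunc F
  -- every element of `A` is a constant
  have hconst : ∀ a ∈ A, ∃ c : F, algebraMap F K c = a := by
    intro a ha
    -- finite places: `a` is a polynomial
    have h1 : a ∈ (algebraMap F[X] K).range := by
      refine IsDedekindDomain.HeightOneSpectrum.mem_integers_of_valuation_le_one K a fun v => ?_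
      have hO : A.toSubring ≤ (v.valuation K).valuationSubring.toSubring := hA _ fun c => by
        change algebraMap F K c ∈ (v.valuation K).valuationSubring
        rw [Valuation.mem_valuationSubring_iff, IsScalarTower.algebraMap_apply F F[X] K]
        exact v.valuation_le_one _
      exact (Valuation.mem_valuationSubring_iff _ _).mp (hO ha)
    obtain ⟨f, rfl⟩ := h1
    -- the place at infinity: the polynomial is constant
    have h2 : RatFunc.inftyValuation F (algebraMap F[X] K f) ≤ 1 := by
      have hO : A.toSubring ≤ (RatFunc.inftyValuation F).valuationSubring.toSubring := hA _ fun c => by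
        change algebraMap F K c ∈ (RatFunc.inftyValuation F).valuationSubring
        rw [Valuation.mem_valuationSubring_iff]
        by_cases hc : c = 0
        · simp [hc]
        · rw [RatFunc.algebraMap_eq_C]
          exact (RatFunc.inftyValuation.C (F := F) hc).le
      exact (Valuation.mem_valuationSubring_iff _ _).mp (hO ha)
    by_cases hf : f = 0
    · exact ⟨0, by simp [hf]⟩
    have hdeg : f.natDegree = 0 := by
      rw [RatFunc.inftyValuation_apply, RatFunc.inftyValuation.polynomial (F := F) hf,
        ← WithZero.exp_zero, WithZero.exp_le_exp] at h2
      omega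
    obtain ⟨c, hc⟩ := Polynomial.natDegree_eq_zero.mp hdeg
    exact ⟨c, by rw [← hc, IsScalarTower.algebraMap_apply F F[X] K, Polynomial.algebraMap_eq]⟩
  -- but `X = a / b` with `a, b ∈ A` constants contradicts `v_∞(X) = exp 1`
  obtain ⟨a, b, -, hx⟩ := IsFractionRing.div_surjective (A := A) (RatFunc.X : K)
  obtain ⟨ca, hca⟩ := hconst a a.2
  obtain ⟨cb, hcb⟩ := hconst b b.2
  have hX : (RatFunc.X : K) = algebraMap F K (ca / cb) := by
    rw [map_div₀, hca, hcb]; exact hx.symm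
  have hv := RatFunc.inftyValuation.X (F := F)
  rw [hX, RatFunc.algebraMap_eq_C] at hv
  by_cases hc : ca / cb = 0
  · simp only [hc, map_zero] at hv
    exact WithZero.exp_ne_zero hv.symm
  · rw [RatFunc.inftyValuation.C (F := F) hc] at hv
    exact absurd (WithZero.exp_eq_one.mp hv.symm) one_ne_zero

/-- In particular no FINITELY GENERATED model of a function field `K/k` of positive transcendence
degree is uniform for all valuations: the shape "one affine chart `A`, `Frac A = K`, with
`A ⊆ O` for every valuation ring `O ⊇ k`" already fails for `K = 𝔽_p(X)`. [folklore] -/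
theorem not_forall_exists_uniform_affineModel (p : ℕ) [Fact p.Prime] :
    ¬ ∀ (k K : Type) [Field k] [CharP k p] [Field K] [Algebra k K],
      (⊤ : IntermediateField k K).FG → ∃ A : Subalgebra k K, A.FG ∧ IsFractionRing A K ∧
        ∀ O : ValuationSubring K, (∀ c : k, algebraMap k K c ∈ O) → A.toSubring ≤ O.toSubring := by
  intro h
  obtain ⟨A, -, hfr, hA⟩ := h (ZMod p) (RatFunc (ZMod p)) (by
    haveI : Algebra.EssFiniteType (ZMod p)[X] (RatFunc (ZMod p)) :=
      Algebra.EssFiniteType.of_isLocalization (RatFunc (ZMod p)) (nonZeroDivisors (ZMod p)[X])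
    exact IntermediateField.fg_top_iff.mpr
      (Algebra.EssFiniteType.comp (ZMod p) (ZMod p)[X] (RatFunc (ZMod p))))
  exact RatFunc.not_exists_model_le_forall_valuationSubring (ZMod p) ⟨A, hfr, hA⟩

/-- **An infinite algebraic extension has no affine model**: no finitely generated
`𝔽_p`-subalgebra of `𝔽_p^alg` has fraction field `𝔽_p^alg` (it would be finite, hence a
finite field equal to its fraction field). [folklore] -/
theorem not_exists_fg_isFractionRing_algebraicClosure (p : ℕ) [Fact p.Prime] :
    ¬ ∃ A : Subalgebra (ZMod p) (AlgebraicClosure (ZMod p)),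
      A.FG ∧ IsFractionRing A (AlgebraicClosure (ZMod p)) := by
  rintro ⟨A, hfg, hfr⟩
  set K := AlgebraicClosure (ZMod p)
  haveI : Algebra.FiniteType (ZMod p) A := A.fg_iff_finiteType.mp hfg
  haveI : Algebra.IsAlgebraic (ZMod p) A :=
    A.isAlgebraic_iff.mp fun x _ => Algebra.IsAlgebraic.isAlgebraic x
  haveI : Algebra.IsIntegral (ZMod p) A := Algebra.IsAlgebraic.isIntegral
  haveI : Module.Finite (ZMod p) A := Algebra.IsIntegral.finite
  haveI : Finite A := Module.finite_of_finite (ZMod p)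
  have hA : IsField A := Finite.isField_of_domain A
  have hbij : Function.Bijective (algebraMap A K) :=
    IsField.localization_map_bijective (M := nonZeroDivisors A) (Rₘ := K)
      (zero_notMem_nonZeroDivisors) hA
  haveI : Finite K := Finite.of_surjective _ hbij.2
  exact not_finite K

/-- Hence **local uniformization demanded for ALL extensions `K/k` is false** (finite
generation of `K/k` dropped from `LUrel_p`; witness `k = 𝔽_p`, `K = 𝔽_p^alg`, `O = ⊤`,
`R = ⊥`): an implication with this antecedent would be vacuously true. [folklore] -/
theorem not_lurel_without_fg (p : ℕ) [Fact p.Prime] :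
    ¬ ∀ (k K : Type) [Field k] [CharP k p] [Field K] [Algebra k K],
      ∀ O : ValuationSubring K, (∀ c : k, algebraMap k K c ∈ O) → ∀ R : Subalgebra k K, R.FG →
        R.toSubring ≤ O.toSubring → ∃ (A : Subalgebra k K) (h : A.toSubring ≤ O.toSubring),
          R ≤ A ∧ A.FG ∧ IsFractionRing A K ∧ IsRegularLocalRing (Localization.AtPrime
            (Ideal.comap (Subring.inclusion h) (IsLocalRing.maximalIdeal O))) := by
  intro h
  obtain ⟨A, -, -, hfg, hfr, -⟩ := h (ZMod p) (AlgebraicClosure (ZMod p)) ⊤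
    (fun c => ValuationSubring.mem_top _) ⊥ Subalgebra.fg_bot (fun x _ => trivial)
  exact not_exists_fg_isFractionRing_algebraicClosure p ⟨A, hfg, hfr⟩

end Literature.AlgebraicGeometry.Resolution

end
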